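import Literature.Topology.FourManifolds.LatticeFormsHyperbolicEmbedding
import HarnessLib

/-!
# `O(U^{⊕3}) → O(U^{⊕3}/2U^{⊕3}, q̄)` is onto: every isometry of the `𝔽₂`-quadratic space `(𝔽₂⁶, x₁y₁ + x₂y₂ + x₃y₃)`
# lifts to an integral isometry of `U^{⊕3}` (the computational core of Nikulin 1980, Thm. 1.14.2 for `U(2)^{⊕3}`)

This file is the finite, computational half of the surjectivity `O(U(2)^{⊕3}) → O(q_{U(2)^{⊕3}})` needed for Huybrechts'
Cor. 14.3.15 (uniqueness of the Kummer lattice `K ↪ H²(X, ℤ)`: "the finer version [of Thm. 1.12] alluded to in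
Remark 1.13, (i)" — Nikulin's Thm. 1.14.2 in the boundary case `rk = ℓ(A_2)`, where `q` splits off `u₊(2)`), reduced
in `KummerLatticeK3EmbeddingUniqueness.lean` (seat p18, g33-#8) to exactly this lifting property. Since `O(U(2)^{⊕3}) =
O(U^{⊕3})` and `(A_{U(2)^{⊕3}}, q) = (U^{⊕3}/2U^{⊕3}, q̄)` with `q̄(v) = ½(v.v) mod 2`, the statement is: every
`q̄`-orthogonal automorphism of `𝔽₂⁶` is the reduction of an integral isometry of `U^{⊕3}`. It is proved here by an
explicit stabiliser chain (Witt's theorem made effective): the reductions of twelve Eichler transvections `t(eᵢ, eⱼ)`,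
`t(eᵢ, fⱼ)`, `t(fᵢ, eⱼ)`, `t(fᵢ, fⱼ)` (Gritsenko–Hulek–Sankaran §3.1) and of the three swaps `eₚ ↔ fₚ` act transitively on
(1) the `35` nonzero singular vectors, (2) the `16` singular `y` with `b̄(e₀, y) = 1` while fixing `e₀`, (3) the `9`
nonzero singular vectors of `⟨e₀, f₀⟩^⊥` while fixing `e₀, f₀`, (4) the `4` singular `y ⊥ e₀, f₀` with `b̄(e₁, y) = 1`
while fixing `e₀, f₀, e₁`; and (5) an isometry fixing `e₀, f₀, e₁, f₁` is the identity or the swap `e₂ ↔ f₂`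
(`35 · 16 · 9 · 4 · 2 = 40320 = |O⁺₆(𝔽₂)|`). The word tables were found by breadth-first search and are CHECKED by the
kernel (`decide`); nothing is assumed. Written for lane `lit-hodgefound` (Track 2 foundations; prover seat
`lit-hodgefound-p18`, gen 33, row g33-#9). DEFINITIONS WITH BODIES (explicit matrices, tables, evaluation maps) and
THEOREMS; no named fact, no instance, no notation.

## Sources

* V. V. Nikulin, *Integral symmetric bilinear forms and some of their applications*, Math. USSR Izv. 14 (1980),
  Thm. 1.14.2 (surjectivity `O(S) → O(q_S)`; boundary case at `p = 2`) — not held, cited through D. Huybrechts,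
  *Lectures on K3 Surfaces*, Ch. 14 Thm. 2.4, Rem. 1.13 (i), Cor. 3.15 (held text
  `book:huybrechtsnd-lectures-k3-surfaces`, p0344, p0341, p0351–p0352).
* V. Gritsenko, K. Hulek, G. K. Sankaran, J. Algebra 322 (2009), §3.1 (t1)–(t3): the Eichler transvections
  `t(e, a) : v ↦ v + (e.v) a − (a.v) e` (`a` isotropic, `a ⊥ e`) and `t(e, a)⁻¹ = t(e, −a)` (held `paper:arxiv-0810.1614`).

## Contents

* §1 the integral Gram matrix `hypSixGram` of `U^{⊕3}` on `Fin 3 ⊕ Fin 3` (`inl p = eₚ`, `inr p = fₚ`), the fifteen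
  integral generators `hypSixGen` with their inverses `hypSixGenInv` and reductions `hypSixGenTwo` (kernel-checked:
  `gᵀ G g = G`, `g g⁻¹ = g⁻¹ g = 1`, `g mod 2 = ḡ`, `ḡ² = 1`, `q̄ ∘ ḡ = q̄`);
* §2 words: `hypSixEval w = ∏ ḡ` (mod 2), `hypSixEvalInt w = ∏ g` (over `ℤ`) with `hypSixEvalInt w mod 2 = hypSixEval w`,
  `(hypSixEvalInt w)ᵀ G (hypSixEvalInt w) = G`, a two-sided inverse, and `hypSixEval w.reverse * hypSixEval w = 1`;
* §3 the tables `hypSixTab1..4` and their kernel-checked specifications;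
* §4 the descent: `exists_hypSixEval_eq` — every `q̄`-orthogonal injective `D ∈ M₆(𝔽₂)` is `hypSixEval w` for a word
  `w`; hence **`exists_integral_lift_of_orthogonal_mod_two`**: every such `D` is the reduction of an integral matrix
  `M` with `Mᵀ G M = G` and an integral inverse.

## References

* [Nikulin1980] V. V. Nikulin, Integral symmetric bilinear forms and some of their applications, Math. USSR Izv. 14
  (1980) 103–167, Thm. 1.14.2.
* [Huybrechts2016K3] D. Huybrechts, Lectures on K3 Surfaces, CUP 2016, Ch. 14 Thm. 2.4, Rem. 1.13 (i), Cor. 3.15.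
* [GritsenkoHulekSankaran2009] V. Gritsenko, K. Hulek, G. K. Sankaran, Abelianisation of orthogonal groups and the
  fundamental group of modular varieties, J. Algebra 322 (2009) 463–478, §3.1.
-/

open scoped Matrix

namespace Literature.Topology.FourManifolds

/-! ### §1 The Gram matrix of `U^{⊕3}`, the generators, their inverses and reductions -/

/-- The Gram matrix of `U^{⊕3}` in the basis `e₀, e₁, e₂` (`inl`), `f₀, f₁, f₂` (`inr`): `eₚ.f_q = δ_{pq}`, `e.e = f.f = 0`.
[cite: Huybrechts2016K3, Ch. 14 §0.3 (ii)] -/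
def hypSixGram : Matrix (Fin 3 ⊕ Fin 3) (Fin 3 ⊕ Fin 3) ℤ := Matrix.fromBlocks 0 1 1 0

/-- The fifteen integral generators: the Eichler transvections `t(e₀,e₁)`, `t(e₀,f₁)`, `t(e₀,e₂)`, `t(e₀,f₂)`,
`t(f₀,e₁)`, `t(f₀,f₁)`, `t(f₀,e₂)`, `t(f₀,f₂)`, `t(e₁,e₂)`, `t(e₁,f₂)`, `t(f₁,e₂)`, `t(f₁,f₂)`
(`t(e, a) v = v + (e.v) a − (a.v) e`, `a` isotropic, `a ⊥ e`) and the swaps `e₀ ↔ f₀`, `e₁ ↔ f₁`, `e₂ ↔ f₂`, as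
integral matrices (blocks `(e,e) (e,f); (f,e) (f,f)`). [cite: GritsenkoHulekSankaran2009, §3.1 (t1), (t2)] -/
def hypSixGen : Fin 15 → Matrix (Fin 3 ⊕ Fin 3) (Fin 3 ⊕ Fin 3) ℤ := ![
    Matrix.fromBlocks !![1, 0, 0; 0, 1, 0; 0, 0, 1] !![0, -1, 0; 1, 0, 0; 0, 0, 0]
      !![0, 0, 0; 0, 0, 0; 0, 0, 0] !![1, 0, 0; 0, 1, 0; 0, 0, 1],
    Matrix.fromBlocks !![1, -1, 0; 0, 1, 0; 0, 0, 1] !![0, 0, 0; 0, 0, 0; 0, 0, 0]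
      !![0, 0, 0; 0, 0, 0; 0, 0, 0] !![1, 0, 0; 1, 1, 0; 0, 0, 1],
    Matrix.fromBlocks !![1, 0, 0; 0, 1, 0; 0, 0, 1] !![0, 0, -1; 0, 0, 0; 1, 0, 0]
      !![0, 0, 0; 0, 0, 0; 0, 0, 0] !![1, 0, 0; 0, 1, 0; 0, 0, 1],
    Matrix.fromBlocks !![1, 0, -1; 0, 1, 0; 0, 0, 1] !![0, 0, 0; 0, 0, 0; 0, 0, 0]
      !![0, 0, 0; 0, 0, 0; 0, 0, 0] !![1, 0, 0; 0, 1, 0; 1, 0, 1],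
    Matrix.fromBlocks !![1, 0, 0; 1, 1, 0; 0, 0, 1] !![0, 0, 0; 0, 0, 0; 0, 0, 0]
      !![0, 0, 0; 0, 0, 0; 0, 0, 0] !![1, -1, 0; 0, 1, 0; 0, 0, 1],
    Matrix.fromBlocks !![1, 0, 0; 0, 1, 0; 0, 0, 1] !![0, 0, 0; 0, 0, 0; 0, 0, 0]
      !![0, -1, 0; 1, 0, 0; 0, 0, 0] !![1, 0, 0; 0, 1, 0; 0, 0, 1],
    Matrix.fromBlocks !![1, 0, 0; 0, 1, 0; 1, 0, 1] !![0, 0, 0; 0, 0, 0; 0, 0, 0]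
      !![0, 0, 0; 0, 0, 0; 0, 0, 0] !![1, 0, -1; 0, 1, 0; 0, 0, 1],
    Matrix.fromBlocks !![1, 0, 0; 0, 1, 0; 0, 0, 1] !![0, 0, 0; 0, 0, 0; 0, 0, 0]
      !![0, 0, -1; 0, 0, 0; 1, 0, 0] !![1, 0, 0; 0, 1, 0; 0, 0, 1],
    Matrix.fromBlocks !![1, 0, 0; 0, 1, 0; 0, 0, 1] !![0, 0, 0; 0, 0, -1; 0, 1, 0]
      !![0, 0, 0; 0, 0, 0; 0, 0, 0] !![1, 0, 0; 0, 1, 0; 0, 0, 1],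
    Matrix.fromBlocks !![1, 0, 0; 0, 1, -1; 0, 0, 1] !![0, 0, 0; 0, 0, 0; 0, 0, 0]
      !![0, 0, 0; 0, 0, 0; 0, 0, 0] !![1, 0, 0; 0, 1, 0; 0, 1, 1],
    Matrix.fromBlocks !![1, 0, 0; 0, 1, 0; 0, 1, 1] !![0, 0, 0; 0, 0, 0; 0, 0, 0]
      !![0, 0, 0; 0, 0, 0; 0, 0, 0] !![1, 0, 0; 0, 1, -1; 0, 0, 1],
    Matrix.fromBlocks !![1, 0, 0; 0, 1, 0; 0, 0, 1] !![0, 0, 0; 0, 0, 0; 0, 0, 0]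
      !![0, 0, 0; 0, 0, -1; 0, 1, 0] !![1, 0, 0; 0, 1, 0; 0, 0, 1],
    Matrix.fromBlocks !![0, 0, 0; 0, 1, 0; 0, 0, 1] !![1, 0, 0; 0, 0, 0; 0, 0, 0]
      !![1, 0, 0; 0, 0, 0; 0, 0, 0] !![0, 0, 0; 0, 1, 0; 0, 0, 1],
    Matrix.fromBlocks !![1, 0, 0; 0, 0, 0; 0, 0, 1] !![0, 0, 0; 0, 1, 0; 0, 0, 0]
      !![0, 0, 0; 0, 1, 0; 0, 0, 0] !![1, 0, 0; 0, 0, 0; 0, 0, 1],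
    Matrix.fromBlocks !![1, 0, 0; 0, 1, 0; 0, 0, 0] !![0, 0, 0; 0, 0, 0; 0, 0, 1]
      !![0, 0, 0; 0, 0, 0; 0, 0, 1] !![1, 0, 0; 0, 1, 0; 0, 0, 0]]

/-- Integral inverses of the generators (`t(e, a)⁻¹ = t(e, −a)`; swaps are involutions).
[cite: GritsenkoHulekSankaran2009, §3.1 (t3)] -/
def hypSixGenInv : Fin 15 → Matrix (Fin 3 ⊕ Fin 3) (Fin 3 ⊕ Fin 3) ℤ := ![
    Matrix.fromBlocks !![1, 0, 0; 0, 1, 0; 0, 0, 1] !![0, 1, 0; -1, 0, 0; 0, 0, 0]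
      !![0, 0, 0; 0, 0, 0; 0, 0, 0] !![1, 0, 0; 0, 1, 0; 0, 0, 1],
    Matrix.fromBlocks !![1, 1, 0; 0, 1, 0; 0, 0, 1] !![0, 0, 0; 0, 0, 0; 0, 0, 0]
      !![0, 0, 0; 0, 0, 0; 0, 0, 0] !![1, 0, 0; -1, 1, 0; 0, 0, 1],
    Matrix.fromBlocks !![1, 0, 0; 0, 1, 0; 0, 0, 1] !![0, 0, 1; 0, 0, 0; -1, 0, 0]
      !![0, 0, 0; 0, 0, 0; 0, 0, 0] !![1, 0, 0; 0, 1, 0; 0, 0, 1],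
    Matrix.fromBlocks !![1, 0, 1; 0, 1, 0; 0, 0, 1] !![0, 0, 0; 0, 0, 0; 0, 0, 0]
      !![0, 0, 0; 0, 0, 0; 0, 0, 0] !![1, 0, 0; 0, 1, 0; -1, 0, 1],
    Matrix.fromBlocks !![1, 0, 0; -1, 1, 0; 0, 0, 1] !![0, 0, 0; 0, 0, 0; 0, 0, 0]
      !![0, 0, 0; 0, 0, 0; 0, 0, 0] !![1, 1, 0; 0, 1, 0; 0, 0, 1],
    Matrix.fromBlocks !![1, 0, 0; 0, 1, 0; 0, 0, 1] !![0, 0, 0; 0, 0, 0; 0, 0, 0]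
      !![0, 1, 0; -1, 0, 0; 0, 0, 0] !![1, 0, 0; 0, 1, 0; 0, 0, 1],
    Matrix.fromBlocks !![1, 0, 0; 0, 1, 0; -1, 0, 1] !![0, 0, 0; 0, 0, 0; 0, 0, 0]
      !![0, 0, 0; 0, 0, 0; 0, 0, 0] !![1, 0, 1; 0, 1, 0; 0, 0, 1],
    Matrix.fromBlocks !![1, 0, 0; 0, 1, 0; 0, 0, 1] !![0, 0, 0; 0, 0, 0; 0, 0, 0]
      !![0, 0, 1; 0, 0, 0; -1, 0, 0] !![1, 0, 0; 0, 1, 0; 0, 0, 1],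
    Matrix.fromBlocks !![1, 0, 0; 0, 1, 0; 0, 0, 1] !![0, 0, 0; 0, 0, 1; 0, -1, 0]
      !![0, 0, 0; 0, 0, 0; 0, 0, 0] !![1, 0, 0; 0, 1, 0; 0, 0, 1],
    Matrix.fromBlocks !![1, 0, 0; 0, 1, 1; 0, 0, 1] !![0, 0, 0; 0, 0, 0; 0, 0, 0]
      !![0, 0, 0; 0, 0, 0; 0, 0, 0] !![1, 0, 0; 0, 1, 0; 0, -1, 1],
    Matrix.fromBlocks !![1, 0, 0; 0, 1, 0; 0, -1, 1] !![0, 0, 0; 0, 0, 0; 0, 0, 0]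
      !![0, 0, 0; 0, 0, 0; 0, 0, 0] !![1, 0, 0; 0, 1, 1; 0, 0, 1],
    Matrix.fromBlocks !![1, 0, 0; 0, 1, 0; 0, 0, 1] !![0, 0, 0; 0, 0, 0; 0, 0, 0]
      !![0, 0, 0; 0, 0, 1; 0, -1, 0] !![1, 0, 0; 0, 1, 0; 0, 0, 1],
    Matrix.fromBlocks !![0, 0, 0; 0, 1, 0; 0, 0, 1] !![1, 0, 0; 0, 0, 0; 0, 0, 0]
      !![1, 0, 0; 0, 0, 0; 0, 0, 0] !![0, 0, 0; 0, 1, 0; 0, 0, 1],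
    Matrix.fromBlocks !![1, 0, 0; 0, 0, 0; 0, 0, 1] !![0, 0, 0; 0, 1, 0; 0, 0, 0]
      !![0, 0, 0; 0, 1, 0; 0, 0, 0] !![1, 0, 0; 0, 0, 0; 0, 0, 1],
    Matrix.fromBlocks !![1, 0, 0; 0, 1, 0; 0, 0, 0] !![0, 0, 0; 0, 0, 0; 0, 0, 1]
      !![0, 0, 0; 0, 0, 0; 0, 0, 1] !![1, 0, 0; 0, 1, 0; 0, 0, 0]]

/-- The generators reduced modulo `2`. [cite: Nikulin1980, Thm. 1.14.2] -/
def hypSixGenTwo : Fin 15 → Matrix (Fin 3 ⊕ Fin 3) (Fin 3 ⊕ Fin 3) (ZMod 2) := ![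
    Matrix.fromBlocks !![1, 0, 0; 0, 1, 0; 0, 0, 1] !![0, 1, 0; 1, 0, 0; 0, 0, 0]
      !![0, 0, 0; 0, 0, 0; 0, 0, 0] !![1, 0, 0; 0, 1, 0; 0, 0, 1],
    Matrix.fromBlocks !![1, 1, 0; 0, 1, 0; 0, 0, 1] !![0, 0, 0; 0, 0, 0; 0, 0, 0]
      !![0, 0, 0; 0, 0, 0; 0, 0, 0] !![1, 0, 0; 1, 1, 0; 0, 0, 1],
    Matrix.fromBlocks !![1, 0, 0; 0, 1, 0; 0, 0, 1] !![0, 0, 1; 0, 0, 0; 1, 0, 0]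
      !![0, 0, 0; 0, 0, 0; 0, 0, 0] !![1, 0, 0; 0, 1, 0; 0, 0, 1],
    Matrix.fromBlocks !![1, 0, 1; 0, 1, 0; 0, 0, 1] !![0, 0, 0; 0, 0, 0; 0, 0, 0]
      !![0, 0, 0; 0, 0, 0; 0, 0, 0] !![1, 0, 0; 0, 1, 0; 1, 0, 1],
    Matrix.fromBlocks !![1, 0, 0; 1, 1, 0; 0, 0, 1] !![0, 0, 0; 0, 0, 0; 0, 0, 0]
      !![0, 0, 0; 0, 0, 0; 0, 0, 0] !![1, 1, 0; 0, 1, 0; 0, 0, 1],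
    Matrix.fromBlocks !![1, 0, 0; 0, 1, 0; 0, 0, 1] !![0, 0, 0; 0, 0, 0; 0, 0, 0]
      !![0, 1, 0; 1, 0, 0; 0, 0, 0] !![1, 0, 0; 0, 1, 0; 0, 0, 1],
    Matrix.fromBlocks !![1, 0, 0; 0, 1, 0; 1, 0, 1] !![0, 0, 0; 0, 0, 0; 0, 0, 0]
      !![0, 0, 0; 0, 0, 0; 0, 0, 0] !![1, 0, 1; 0, 1, 0; 0, 0, 1],
    Matrix.fromBlocks !![1, 0, 0; 0, 1, 0; 0, 0, 1] !![0, 0, 0; 0, 0, 0; 0, 0, 0]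
      !![0, 0, 1; 0, 0, 0; 1, 0, 0] !![1, 0, 0; 0, 1, 0; 0, 0, 1],
    Matrix.fromBlocks !![1, 0, 0; 0, 1, 0; 0, 0, 1] !![0, 0, 0; 0, 0, 1; 0, 1, 0]
      !![0, 0, 0; 0, 0, 0; 0, 0, 0] !![1, 0, 0; 0, 1, 0; 0, 0, 1],
    Matrix.fromBlocks !![1, 0, 0; 0, 1, 1; 0, 0, 1] !![0, 0, 0; 0, 0, 0; 0, 0, 0]
      !![0, 0, 0; 0, 0, 0; 0, 0, 0] !![1, 0, 0; 0, 1, 0; 0, 1, 1],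
    Matrix.fromBlocks !![1, 0, 0; 0, 1, 0; 0, 1, 1] !![0, 0, 0; 0, 0, 0; 0, 0, 0]
      !![0, 0, 0; 0, 0, 0; 0, 0, 0] !![1, 0, 0; 0, 1, 1; 0, 0, 1],
    Matrix.fromBlocks !![1, 0, 0; 0, 1, 0; 0, 0, 1] !![0, 0, 0; 0, 0, 0; 0, 0, 0]
      !![0, 0, 0; 0, 0, 1; 0, 1, 0] !![1, 0, 0; 0, 1, 0; 0, 0, 1],
    Matrix.fromBlocks !![0, 0, 0; 0, 1, 0; 0, 0, 1] !![1, 0, 0; 0, 0, 0; 0, 0, 0]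
      !![1, 0, 0; 0, 0, 0; 0, 0, 0] !![0, 0, 0; 0, 1, 0; 0, 0, 1],
    Matrix.fromBlocks !![1, 0, 0; 0, 0, 0; 0, 0, 1] !![0, 0, 0; 0, 1, 0; 0, 0, 0]
      !![0, 0, 0; 0, 1, 0; 0, 0, 0] !![1, 0, 0; 0, 0, 0; 0, 0, 1],
    Matrix.fromBlocks !![1, 0, 0; 0, 1, 0; 0, 0, 0] !![0, 0, 0; 0, 0, 0; 0, 0, 1]
      !![0, 0, 0; 0, 0, 0; 0, 0, 1] !![1, 0, 0; 0, 1, 0; 0, 0, 0]]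

/-- Each generator is an integral isometry of `U^{⊕3}`: `gᵀ G g = G`. [cite: GritsenkoHulekSankaran2009, §3.1 (t2)] -/
theorem hypSixGen_transpose_mul_mul (k : Fin 15) : (hypSixGen k)ᵀ * hypSixGram * hypSixGen k = hypSixGram := by
  revert k
  decide

/-- `g g⁻¹ = 1`. [cite: GritsenkoHulekSankaran2009, §3.1 (t3)] -/
theorem hypSixGen_mul_inv (k : Fin 15) : hypSixGen k * hypSixGenInv k = 1 := by
  revert k
  decide

/-- `g⁻¹ g = 1`. [cite: GritsenkoHulekSankaran2009, §3.1 (t3)] -/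
theorem hypSixGenInv_mul (k : Fin 15) : hypSixGenInv k * hypSixGen k = 1 := by
  revert k
  decide

/-- The reduction of `g` modulo `2` is `ḡ`. [cite: Nikulin1980, Thm. 1.14.2] -/
theorem hypSixGen_map (k : Fin 15) : (hypSixGen k).map (Int.castRingHom (ZMod 2)) = hypSixGenTwo k := by
  revert k
  decide

/-- Every `ḡ` is an involution (`t(e,a)² = t(e,2a) ≡ 1 mod 2`). [folklore] -/
private theorem hypSixGenTwo_mul_self (k : Fin 15) : hypSixGenTwo k * hypSixGenTwo k = 1 := by
  revert k
  decide

/-- The quadratic form `q̄(v) = v(e₀)v(f₀) + v(e₁)v(f₁) + v(e₂)v(f₂)` on `𝔽₂⁶` (the discriminant quadratic form of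
`U(2)^{⊕3}`, `q(x/2) = ½(x.x) mod 2`). [cite: Huybrechts2016K3, Ch. 14 §0.3 (iv) and Prop. 3.14 (iv)] -/
def hypSixQuadTwo (v : Fin 3 ⊕ Fin 3 → ZMod 2) : ZMod 2 :=
  v (Sum.inl 0) * v (Sum.inr 0) + v (Sum.inl 1) * v (Sum.inr 1) + v (Sum.inl 2) * v (Sum.inr 2)

/-- The polar bilinear form `b̄(u, v) = Σₚ (u(eₚ)v(fₚ) + u(fₚ)v(eₚ))` of `q̄`. [cite: Huybrechts2016K3, Ch. 14 §0.1 (discriminant forms)] -/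
def hypSixBilinTwo (u v : Fin 3 ⊕ Fin 3 → ZMod 2) : ZMod 2 :=
  u (Sum.inl 0) * v (Sum.inr 0) + u (Sum.inr 0) * v (Sum.inl 0) + (u (Sum.inl 1) * v (Sum.inr 1) +
    u (Sum.inr 1) * v (Sum.inl 1)) + (u (Sum.inl 2) * v (Sum.inr 2) + u (Sum.inr 2) * v (Sum.inl 2))

/-- Polarisation: `q̄(u + v) = q̄(u) + q̄(v) + b̄(u, v)`. [folklore] -/
private theorem hypSixQuadTwo_add (u v : Fin 3 ⊕ Fin 3 → ZMod 2) :
    hypSixQuadTwo (u + v) = hypSixQuadTwo u + hypSixQuadTwo v + hypSixBilinTwo u v := by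
  simp only [hypSixQuadTwo, hypSixBilinTwo, Pi.add_apply]
  ring

/-- Every `ḡ` preserves `q̄`. [folklore] -/
private theorem hypSixQuadTwo_genTwo_mulVec (k : Fin 15) (v : Fin 3 ⊕ Fin 3 → ZMod 2) :
    hypSixQuadTwo (hypSixGenTwo k *ᵥ v) = hypSixQuadTwo v := by
  revert k v
  decide

/-! ### §2 Words in the generators, over `𝔽₂` and over `ℤ` -/

/-- The product `ḡ_{w₁} ⋯ ḡ_{wₙ}` of a word of reduced generators. [folklore] -/
def hypSixEval (w : List (Fin 15)) : Matrix (Fin 3 ⊕ Fin 3) (Fin 3 ⊕ Fin 3) (ZMod 2) :=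
  w.foldr (fun k M ↦ hypSixGenTwo k * M) 1

/-- The action of a word on a vector: `w • v = ḡ_{w₁} (⋯ (ḡ_{wₙ} v))`. [folklore] -/
def hypSixAct (w : List (Fin 15)) (v : Fin 3 ⊕ Fin 3 → ZMod 2) : Fin 3 ⊕ Fin 3 → ZMod 2 :=
  w.foldr (fun k u ↦ hypSixGenTwo k *ᵥ u) v

/-- The integral product `g_{w₁} ⋯ g_{wₙ}`. [folklore] -/
def hypSixEvalInt (w : List (Fin 15)) : Matrix (Fin 3 ⊕ Fin 3) (Fin 3 ⊕ Fin 3) ℤ :=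
  w.foldr (fun k M ↦ hypSixGen k * M) 1

/-- The integral inverse `g_{wₙ}⁻¹ ⋯ g_{w₁}⁻¹`. [folklore] -/
def hypSixEvalIntInv (w : List (Fin 15)) : Matrix (Fin 3 ⊕ Fin 3) (Fin 3 ⊕ Fin 3) ℤ :=
  w.foldr (fun k M ↦ M * hypSixGenInv k) 1

/-- Unfolding on the empty word. [folklore] -/
@[simp] private theorem hypSixEval_nil : hypSixEval [] = 1 := rfl

/-- Unfolding on `k :: w`. [folklore] -/
@[simp] private theorem hypSixEval_cons (k : Fin 15) (w : List (Fin 15)) :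
    hypSixEval (k :: w) = hypSixGenTwo k * hypSixEval w := rfl

/-- Unfolding on the empty word. [folklore] -/
@[simp] private theorem hypSixAct_nil (v : Fin 3 ⊕ Fin 3 → ZMod 2) : hypSixAct [] v = v := rfl

/-- Unfolding on `k :: w`. [folklore] -/
@[simp] private theorem hypSixAct_cons (k : Fin 15) (w : List (Fin 15)) (v : Fin 3 ⊕ Fin 3 → ZMod 2) :
    hypSixAct (k :: w) v = hypSixGenTwo k *ᵥ hypSixAct w v := rfl

/-- Unfolding on the empty word. [folklore] -/
@[simp] private theorem hypSixEvalInt_nil : hypSixEvalInt [] = 1 := rfl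

/-- Unfolding on `k :: w`. [folklore] -/
@[simp] private theorem hypSixEvalInt_cons (k : Fin 15) (w : List (Fin 15)) :
    hypSixEvalInt (k :: w) = hypSixGen k * hypSixEvalInt w := rfl

/-- Unfolding on the empty word. [folklore] -/
@[simp] private theorem hypSixEvalIntInv_nil : hypSixEvalIntInv [] = 1 := rfl

/-- Unfolding on `k :: w`. [folklore] -/
@[simp] private theorem hypSixEvalIntInv_cons (k : Fin 15) (w : List (Fin 15)) :
    hypSixEvalIntInv (k :: w) = hypSixEvalIntInv w * hypSixGenInv k := rfl

/-- `(∏ ḡ) v = w • v`. [folklore] -/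
private theorem hypSixEval_mulVec (w : List (Fin 15)) (v : Fin 3 ⊕ Fin 3 → ZMod 2) :
    hypSixEval w *ᵥ v = hypSixAct w v := by
  induction w with
  | nil => simp
  | cons k w ih => rw [hypSixEval_cons, hypSixAct_cons, ← ih, Matrix.mulVec_mulVec]

/-- Concatenation of words is multiplication. [folklore] -/
private theorem hypSixEval_append (w w' : List (Fin 15)) : hypSixEval (w ++ w') = hypSixEval w * hypSixEval w' := by
  induction w with
  | nil => simp
  | cons k w ih => rw [List.cons_append, hypSixEval_cons, hypSixEval_cons, ih, Matrix.mul_assoc]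

/-- The reversed word is a left inverse (all `ḡ` are involutions). [folklore] -/
private theorem hypSixEval_reverse_mul (w : List (Fin 15)) : hypSixEval w.reverse * hypSixEval w = 1 := by
  induction w with
  | nil => simp
  | cons k w ih =>
    rw [List.reverse_cons, hypSixEval_append, hypSixEval_cons, hypSixEval_cons, hypSixEval_nil, Matrix.mul_one,
      Matrix.mul_assoc, ← Matrix.mul_assoc (hypSixGenTwo k), hypSixGenTwo_mul_self, Matrix.one_mul, ih]

/-- The reversed word is a right inverse. [folklore] -/
private theorem hypSixEval_mul_reverse (w : List (Fin 15)) : hypSixEval w * hypSixEval w.reverse = 1 := by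
  simpa using hypSixEval_reverse_mul w.reverse

/-- Words preserve `q̄`. [folklore] -/
private theorem hypSixQuadTwo_hypSixAct (w : List (Fin 15)) (v : Fin 3 ⊕ Fin 3 → ZMod 2) :
    hypSixQuadTwo (hypSixAct w v) = hypSixQuadTwo v := by
  induction w with
  | nil => simp
  | cons k w ih => rw [hypSixAct_cons, hypSixQuadTwo_genTwo_mulVec, ih]

/-- **The integral word is an isometry of `U^{⊕3}`**: `(∏ g)ᵀ G (∏ g) = G`. [cite: GritsenkoHulekSankaran2009, §3.1 (t2)] -/
theorem hypSixEvalInt_transpose_mul_mul (w : List (Fin 15)) :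
    (hypSixEvalInt w)ᵀ * hypSixGram * hypSixEvalInt w = hypSixGram := by
  induction w with
  | nil => simp
  | cons k w ih =>
    rw [hypSixEvalInt_cons, Matrix.transpose_mul, Matrix.mul_assoc, Matrix.mul_assoc,
      ← Matrix.mul_assoc (hypSixGen k)ᵀ, ← Matrix.mul_assoc ((hypSixGen k)ᵀ * hypSixGram), hypSixGen_transpose_mul_mul,
      ← Matrix.mul_assoc, ih]

/-- `(∏ g) (∏ g)⁻¹ = 1`. [cite: GritsenkoHulekSankaran2009, §3.1 (t3)] -/
theorem hypSixEvalInt_mul_inv (w : List (Fin 15)) : hypSixEvalInt w * hypSixEvalIntInv w = 1 := by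
  induction w with
  | nil => simp
  | cons k w ih =>
    rw [hypSixEvalInt_cons, hypSixEvalIntInv_cons, Matrix.mul_assoc, ← Matrix.mul_assoc (hypSixEvalInt w), ih,
      Matrix.one_mul, hypSixGen_mul_inv]

/-- `(∏ g)⁻¹ (∏ g) = 1`. [cite: GritsenkoHulekSankaran2009, §3.1 (t3)] -/
theorem hypSixEvalIntInv_mul (w : List (Fin 15)) : hypSixEvalIntInv w * hypSixEvalInt w = 1 := by
  induction w with
  | nil => simp
  | cons k w ih =>
    rw [hypSixEvalInt_cons, hypSixEvalIntInv_cons, Matrix.mul_assoc, ← Matrix.mul_assoc (hypSixGenInv k),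
      hypSixGenInv_mul, Matrix.one_mul, ih]

/-- **Reduction modulo `2` of the integral word is the `𝔽₂`-word.** [cite: Nikulin1980, Thm. 1.14.2] -/
theorem hypSixEvalInt_map (w : List (Fin 15)) :
    (hypSixEvalInt w).map (Int.castRingHom (ZMod 2)) = hypSixEval w := by
  induction w with
  | nil => simp
  | cons k w ih => rw [hypSixEvalInt_cons, hypSixEval_cons, Matrix.map_mul, hypSixGen_map, ih]

/-! ### §3 The word tables of the stabiliser chain and their kernel-checked specifications -/

/-- The code `Σ 2^i vᵢ ∈ {0, …, 63}` of a vector of `𝔽₂⁶` (bit order `e₀ f₀ e₁ f₁ e₂ f₂`), indexing the tables. [folklore] -/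
def hypSixCode (v : Fin 3 ⊕ Fin 3 → ZMod 2) : ℕ :=
  (v (Sum.inl 0)).val + 2 * (v (Sum.inr 0)).val + 4 * (v (Sum.inl 1)).val + 8 * (v (Sum.inr 1)).val +
    16 * (v (Sum.inl 2)).val + 32 * (v (Sum.inr 2)).val

/-- Word table, step 1: at the code of a nonzero singular `v`, a word `w` with `w • e₀ = v` (breadth-first search).
[folklore] -/
def hypSixTab1 : List (List (Fin 15)) :=
  [[], [], [12], [], [1, 4], [4], [12, 4], [],
   [0, 5], [5], [12, 5], [], [], [], [], [5, 4],
   [3, 6], [6], [12, 6], [], [10, 1, 4], [6, 4], [12, 6, 4], [],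
   [8, 0, 5], [6, 5], [12, 6, 5], [], [], [], [], [2, 5, 4],
   [2, 7], [7], [12, 7], [], [11, 1, 4], [7, 4], [12, 7, 4], [],
   [9, 0, 5], [7, 5], [12, 7, 5], [], [], [], [], [3, 5, 4],
   [], [], [], [7, 6], [], [], [], [7, 6, 4],
   [], [], [], [7, 6, 5], [11, 10, 1, 4], [11, 6, 4], [3, 2, 5, 4], []]

/-- Word table, step 2: at the code of `y` with `q̄ y = 0`, `b̄(e₀, y) = 1`, a word fixing `e₀` with `w • f₀ = y`.
[folklore] -/
def hypSixTab2 : List (List (Fin 15)) :=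
  [[], [], [], [], [], [], [0], [],
   [], [], [1], [], [], [], [], [1, 0],
   [], [], [2], [], [], [], [2, 0], [],
   [], [], [2, 1], [], [], [], [], [2, 1, 0],
   [], [], [3], [], [], [], [3, 0], [],
   [], [], [3, 1], [], [], [], [], [3, 1, 0],
   [], [], [], [3, 2], [], [], [], [3, 2, 0],
   [], [], [], [3, 2, 1], [], [], [11, 2, 0], []]

/-- Word table, step 3: at the code of a nonzero singular `v ⊥ e₀, f₀`, a word fixing `e₀, f₀` with `w • e₁ = v`.
[folklore] -/
def hypSixTab3 : List (List (Fin 15)) :=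
  [[], [], [], [], [], [], [], [],
   [13], [], [], [], [], [], [], [],
   [9, 10], [], [], [], [10], [], [], [],
   [13, 10], [], [], [], [], [], [], [],
   [8, 11], [], [], [], [11], [], [], [],
   [13, 11], [], [], [], [], [], [], [],
   [], [], [], [], [], [], [], [],
   [], [], [], [], [11, 10], [], [], []]

/-- Word table, step 4: at the code of `y ⊥ e₀, f₀` with `q̄ y = 0`, `b̄(e₁, y) = 1`, a word fixing `e₀, f₀, e₁` with
`w • f₁ = y`. [folklore] -/
def hypSixTab4 : List (List (Fin 15)) :=
  [[], [], [], [], [], [], [], [],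
   [], [], [], [], [], [], [], [],
   [], [], [], [], [], [], [], [],
   [8], [], [], [], [], [], [], [],
   [], [], [], [], [], [], [], [],
   [9], [], [], [], [], [], [], [],
   [], [], [], [], [], [], [], [],
   [], [], [], [], [9, 8], [], [], []]

/-- The basis vector `eₚ` of `𝔽₂⁶`. [folklore] -/
def hypSixE (p : Fin 3) : Fin 3 ⊕ Fin 3 → ZMod 2 := Pi.single (Sum.inl p) 1

/-- The basis vector `fₚ` of `𝔽₂⁶`. [folklore] -/
def hypSixF (p : Fin 3) : Fin 3 ⊕ Fin 3 → ZMod 2 := Pi.single (Sum.inr p) 1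

/-- Step 1 (transitivity on nonzero singular vectors), checked by the kernel. [folklore] -/
private theorem hypSixTab1_spec : ∀ v : Fin 3 ⊕ Fin 3 → ZMod 2, hypSixQuadTwo v = 0 → v ≠ 0 →
    hypSixAct (hypSixTab1.getD (hypSixCode v) []) (hypSixE 0) = v := by
  decide

/-- Step 2 (the stabiliser of `e₀` is transitive on singular `y` with `b̄(e₀, y) = 1`), checked by the kernel. [folklore] -/
private theorem hypSixTab2_spec : ∀ y : Fin 3 ⊕ Fin 3 → ZMod 2, hypSixQuadTwo y = 0 →
    hypSixBilinTwo (hypSixE 0) y = 1 →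
    hypSixAct (hypSixTab2.getD (hypSixCode y) []) (hypSixE 0) = hypSixE 0 ∧
      hypSixAct (hypSixTab2.getD (hypSixCode y) []) (hypSixF 0) = y := by
  decide

/-- Step 3 (transitivity on nonzero singular vectors of `⟨e₀, f₀⟩^⊥`, fixing `e₀, f₀`), checked by the kernel. [folklore] -/
private theorem hypSixTab3_spec : ∀ v : Fin 3 ⊕ Fin 3 → ZMod 2, hypSixQuadTwo v = 0 → v ≠ 0 →
    hypSixBilinTwo (hypSixE 0) v = 0 → hypSixBilinTwo (hypSixF 0) v = 0 →
    hypSixAct (hypSixTab3.getD (hypSixCode v) []) (hypSixE 0) = hypSixE 0 ∧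
      hypSixAct (hypSixTab3.getD (hypSixCode v) []) (hypSixF 0) = hypSixF 0 ∧
        hypSixAct (hypSixTab3.getD (hypSixCode v) []) (hypSixE 1) = v := by
  decide

/-- Step 4 (fixing `e₀, f₀, e₁`, transitivity on singular `y ⊥ e₀, f₀` with `b̄(e₁, y) = 1`), checked by the kernel.
[folklore] -/
private theorem hypSixTab4_spec : ∀ y : Fin 3 ⊕ Fin 3 → ZMod 2, (hypSixQuadTwo y = 0 ∧
    hypSixBilinTwo (hypSixE 1) y = 1 ∧ hypSixBilinTwo (hypSixE 0) y = 0 ∧ hypSixBilinTwo (hypSixF 0) y = 0) →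
    hypSixAct (hypSixTab4.getD (hypSixCode y) []) (hypSixE 0) = hypSixE 0 ∧
      hypSixAct (hypSixTab4.getD (hypSixCode y) []) (hypSixF 0) = hypSixF 0 ∧
        hypSixAct (hypSixTab4.getD (hypSixCode y) []) (hypSixE 1) = hypSixE 1 ∧
          hypSixAct (hypSixTab4.getD (hypSixCode y) []) (hypSixF 1) = y := by
  decide

/-- The (decidable, Boolean) hypothesis of step 5: `u, v` singular, `b̄(u,v) = 1`, both orthogonal to
`e₀, f₀, e₁, f₁`. [folklore] -/
def hypSixStep5Cond (u v : Fin 3 ⊕ Fin 3 → ZMod 2) : Bool :=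
  decide (hypSixQuadTwo u = 0) && decide (hypSixQuadTwo v = 0) && decide (hypSixBilinTwo u v = 1) &&
    decide (hypSixBilinTwo (hypSixE 0) u = 0) && decide (hypSixBilinTwo (hypSixF 0) u = 0) &&
    decide (hypSixBilinTwo (hypSixE 1) u = 0) && decide (hypSixBilinTwo (hypSixF 1) u = 0) &&
    decide (hypSixBilinTwo (hypSixE 0) v = 0) && decide (hypSixBilinTwo (hypSixF 0) v = 0) &&
    decide (hypSixBilinTwo (hypSixE 1) v = 0) && decide (hypSixBilinTwo (hypSixF 1) v = 0)

set_option synthInstance.maxSize 4096 in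
set_option synthInstance.maxHeartbeats 800000 in
set_option maxRecDepth 4096 in
/-- Step 5: singular `u, v` orthogonal to `e₀, f₀, e₁, f₁` with `b̄(u, v) = 1` are `{e₂, f₂}`, checked by the kernel
[folklore] -/
private theorem hypSixStep5_spec :
    ∀ u v : Fin 3 ⊕ Fin 3 → ZMod 2, hypSixStep5Cond u v = true →
    (u = hypSixE 2 ∧ v = hypSixF 2) ∨ (u = hypSixF 2 ∧ v = hypSixE 2) := by
  decide

/-- The swap `e₂ ↔ f₂` (generator `14`) on the basis, checked by the kernel. [folklore] -/
private theorem hypSixGenTwo_swap_spec :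
    hypSixGenTwo 14 *ᵥ hypSixE 0 = hypSixE 0 ∧ hypSixGenTwo 14 *ᵥ hypSixF 0 = hypSixF 0 ∧
      hypSixGenTwo 14 *ᵥ hypSixE 1 = hypSixE 1 ∧ hypSixGenTwo 14 *ᵥ hypSixF 1 = hypSixF 1 ∧
        hypSixGenTwo 14 *ᵥ hypSixE 2 = hypSixF 2 ∧ hypSixGenTwo 14 *ᵥ hypSixF 2 = hypSixE 2 := by
  decide

/-- Values of `q̄`, `b̄` on the basis used in the descent, checked by the kernel. [folklore] -/
private theorem hypSix_basis_values :
    hypSixQuadTwo (hypSixE 0) = 0 ∧ hypSixQuadTwo (hypSixF 0) = 0 ∧ hypSixQuadTwo (hypSixE 1) = 0 ∧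
      hypSixQuadTwo (hypSixF 1) = 0 ∧ hypSixQuadTwo (hypSixE 2) = 0 ∧ hypSixQuadTwo (hypSixF 2) = 0 ∧
      hypSixBilinTwo (hypSixE 0) (hypSixF 0) = 1 ∧ hypSixBilinTwo (hypSixE 0) (hypSixE 1) = 0 ∧
      hypSixBilinTwo (hypSixF 0) (hypSixE 1) = 0 ∧ hypSixBilinTwo (hypSixE 1) (hypSixF 1) = 1 ∧
      hypSixBilinTwo (hypSixE 0) (hypSixF 1) = 0 ∧ hypSixBilinTwo (hypSixF 0) (hypSixF 1) = 0 ∧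
      hypSixBilinTwo (hypSixE 2) (hypSixF 2) = 1 ∧
      hypSixBilinTwo (hypSixE 0) (hypSixE 2) = 0 ∧ hypSixBilinTwo (hypSixF 0) (hypSixE 2) = 0 ∧
      hypSixBilinTwo (hypSixE 1) (hypSixE 2) = 0 ∧ hypSixBilinTwo (hypSixF 1) (hypSixE 2) = 0 ∧
      hypSixBilinTwo (hypSixE 0) (hypSixF 2) = 0 ∧ hypSixBilinTwo (hypSixF 0) (hypSixF 2) = 0 ∧
      hypSixBilinTwo (hypSixE 1) (hypSixF 2) = 0 ∧ hypSixBilinTwo (hypSixF 1) (hypSixF 2) = 0 ∧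
      hypSixE 0 ≠ 0 ∧ hypSixE 1 ≠ 0 := by
  decide

/-! ### §4 The descent: every `q̄`-orthogonal automorphism of `𝔽₂⁶` is a word, hence lifts to `O(U^{⊕3})` -/

section Descent

variable (D : Matrix (Fin 3 ⊕ Fin 3) (Fin 3 ⊕ Fin 3) (ZMod 2))

/-- A `q̄`-preserving linear map preserves `b̄` (polarisation). [folklore] -/
private theorem hypSixBilinTwo_mulVec (hq : ∀ v, hypSixQuadTwo (D *ᵥ v) = hypSixQuadTwo v)
    (u v : Fin 3 ⊕ Fin 3 → ZMod 2) : hypSixBilinTwo (D *ᵥ u) (D *ᵥ v) = hypSixBilinTwo u v := by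
  have h := hypSixQuadTwo_add (D *ᵥ u) (D *ᵥ v)
  rw [← Matrix.mulVec_add, hq, hq, hq, hypSixQuadTwo_add] at h
  exact (add_left_cancel h).symm

/-- Left multiplication by a word keeps `q̄`-orthogonality. [folklore] -/
private theorem hypSix_orth_eval_mul (w : List (Fin 15)) (hq : ∀ v, hypSixQuadTwo (D *ᵥ v) = hypSixQuadTwo v)
    (v : Fin 3 ⊕ Fin 3 → ZMod 2) : hypSixQuadTwo ((hypSixEval w * D) *ᵥ v) = hypSixQuadTwo v := by
  rw [← Matrix.mulVec_mulVec, hypSixEval_mulVec, hypSixQuadTwo_hypSixAct, hq]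

/-- Left multiplication by a word keeps injectivity. [folklore] -/
private theorem hypSix_inj_eval_mul (w : List (Fin 15)) (hinj : Function.Injective D.mulVec) :
    Function.Injective (hypSixEval w * D).mulVec := by
  intro u v huv
  apply hinj
  have h := congrArg (fun x ↦ hypSixEval w.reverse *ᵥ x) huv
  simp only [Matrix.mulVec_mulVec, ← Matrix.mul_assoc, hypSixEval_reverse_mul, Matrix.one_mul] at h
  exact h

/-- Undoing a word: if `(∏ ḡ_w) D = E` then `D = (∏ ḡ_{w.reverse}) E`. [folklore] -/
private theorem hypSix_eq_reverse_mul {w : List (Fin 15)} {E : Matrix (Fin 3 ⊕ Fin 3) (Fin 3 ⊕ Fin 3) (ZMod 2)}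
    (h : hypSixEval w * D = E) : D = hypSixEval w.reverse * E := by
  rw [← h, ← Matrix.mul_assoc, hypSixEval_reverse_mul, Matrix.one_mul]

/-- Step 1: some word moves `D e₀` back to `e₀`. [folklore] -/
private theorem hypSix_step1 (hq : ∀ v, hypSixQuadTwo (D *ᵥ v) = hypSixQuadTwo v)
    (hinj : Function.Injective D.mulVec) :
    ∃ w : List (Fin 15), (hypSixEval w * D) *ᵥ hypSixE 0 = hypSixE 0 := by
  obtain ⟨hqe0, -, -, -, -, -, -, -, -, -, -, -, -, -, -, -, -, -, -, -, -, he0, -⟩ := hypSix_basis_values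
  set v := D *ᵥ hypSixE 0 with hv
  have hqv : hypSixQuadTwo v = 0 := by rw [hv, hq, hqe0]
  have hv0 : v ≠ 0 := fun h ↦ he0 (hinj (by rw [← hv, h, Matrix.mulVec_zero]))
  have h1 := hypSixTab1_spec v hqv hv0
  set w := hypSixTab1.getD (hypSixCode v) [] with hw
  refine ⟨w.reverse, ?_⟩
  rw [← Matrix.mulVec_mulVec, ← hv]
  conv_lhs => rw [← h1, ← hypSixEval_mulVec, Matrix.mulVec_mulVec, hypSixEval_reverse_mul, Matrix.one_mulVec]

/-- Step 2: if `D e₀ = e₀`, some word fixing `e₀` moves `D f₀` back to `f₀`. [folklore] -/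
private theorem hypSix_step2 (hq : ∀ v, hypSixQuadTwo (D *ᵥ v) = hypSixQuadTwo v)
    (he0 : D *ᵥ hypSixE 0 = hypSixE 0) :
    ∃ w : List (Fin 15), (hypSixEval w * D) *ᵥ hypSixE 0 = hypSixE 0 ∧ (hypSixEval w * D) *ᵥ hypSixF 0 = hypSixF 0 := by
  obtain ⟨-, hqf0, -, -, -, -, hb, -⟩ := hypSix_basis_values
  set y := D *ᵥ hypSixF 0 with hy
  have hqy : hypSixQuadTwo y = 0 := by rw [hy, hq, hqf0]
  have hby : hypSixBilinTwo (hypSixE 0) y = 1 := by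
    rw [hy, ← he0, hypSixBilinTwo_mulVec D hq, hb]
  obtain ⟨h1, h2⟩ := hypSixTab2_spec y hqy hby
  set w := hypSixTab2.getD (hypSixCode y) []
  refine ⟨w.reverse, ?_, ?_⟩
  · rw [← Matrix.mulVec_mulVec, he0]
    conv_lhs => rw [← h1, ← hypSixEval_mulVec, Matrix.mulVec_mulVec, hypSixEval_reverse_mul, Matrix.one_mulVec]
  · rw [← Matrix.mulVec_mulVec, ← hy]
    conv_lhs => rw [← h2, ← hypSixEval_mulVec, Matrix.mulVec_mulVec, hypSixEval_reverse_mul, Matrix.one_mulVec]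

/-- Step 3: if `D` fixes `e₀, f₀`, some word fixing `e₀, f₀` moves `D e₁` back to `e₁`. [folklore] -/
private theorem hypSix_step3 (hq : ∀ v, hypSixQuadTwo (D *ᵥ v) = hypSixQuadTwo v)
    (hinj : Function.Injective D.mulVec) (he0 : D *ᵥ hypSixE 0 = hypSixE 0) (hf0 : D *ᵥ hypSixF 0 = hypSixF 0) :
    ∃ w : List (Fin 15), (hypSixEval w * D) *ᵥ hypSixE 0 = hypSixE 0 ∧ (hypSixEval w * D) *ᵥ hypSixF 0 = hypSixF 0 ∧
      (hypSixEval w * D) *ᵥ hypSixE 1 = hypSixE 1 := by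
  obtain ⟨-, -, hqe1, -, -, -, -, hb1, hb2, -, -, -, -, -, -, -, -, -, -, -, -, -, he1⟩ := hypSix_basis_values
  set v := D *ᵥ hypSixE 1 with hv
  have hqv : hypSixQuadTwo v = 0 := by rw [hv, hq, hqe1]
  have hv0 : v ≠ 0 := fun h ↦ he1 (hinj (by rw [← hv, h, Matrix.mulVec_zero]))
  have hb1' : hypSixBilinTwo (hypSixE 0) v = 0 := by rw [hv, ← he0, hypSixBilinTwo_mulVec D hq, hb1]
  have hb2' : hypSixBilinTwo (hypSixF 0) v = 0 := by rw [hv, ← hf0, hypSixBilinTwo_mulVec D hq, hb2]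
  obtain ⟨h1, h2, h3⟩ := hypSixTab3_spec v hqv hv0 hb1' hb2'
  set w := hypSixTab3.getD (hypSixCode v) []
  refine ⟨w.reverse, ?_, ?_, ?_⟩
  · rw [← Matrix.mulVec_mulVec, he0]
    conv_lhs => rw [← h1, ← hypSixEval_mulVec, Matrix.mulVec_mulVec, hypSixEval_reverse_mul, Matrix.one_mulVec]
  · rw [← Matrix.mulVec_mulVec, hf0]
    conv_lhs => rw [← h2, ← hypSixEval_mulVec, Matrix.mulVec_mulVec, hypSixEval_reverse_mul, Matrix.one_mulVec]
  · rw [← Matrix.mulVec_mulVec, ← hv]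
    conv_lhs => rw [← h3, ← hypSixEval_mulVec, Matrix.mulVec_mulVec, hypSixEval_reverse_mul, Matrix.one_mulVec]

/-- Step 4: if `D` fixes `e₀, f₀, e₁`, some word fixing them moves `D f₁` back to `f₁`. [folklore] -/
private theorem hypSix_step4 (hq : ∀ v, hypSixQuadTwo (D *ᵥ v) = hypSixQuadTwo v)
    (he0 : D *ᵥ hypSixE 0 = hypSixE 0) (hf0 : D *ᵥ hypSixF 0 = hypSixF 0) (he1 : D *ᵥ hypSixE 1 = hypSixE 1) :
    ∃ w : List (Fin 15), (hypSixEval w * D) *ᵥ hypSixE 0 = hypSixE 0 ∧ (hypSixEval w * D) *ᵥ hypSixF 0 = hypSixF 0 ∧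
      (hypSixEval w * D) *ᵥ hypSixE 1 = hypSixE 1 ∧ (hypSixEval w * D) *ᵥ hypSixF 1 = hypSixF 1 := by
  obtain ⟨-, -, -, hqf1, -, -, -, -, -, hb, hb1, hb2, -⟩ := hypSix_basis_values
  set y := D *ᵥ hypSixF 1 with hy
  have hqy : hypSixQuadTwo y = 0 := by rw [hy, hq, hqf1]
  have hby : hypSixBilinTwo (hypSixE 1) y = 1 := by rw [hy, ← he1, hypSixBilinTwo_mulVec D hq, hb]
  have hb1' : hypSixBilinTwo (hypSixE 0) y = 0 := by rw [hy, ← he0, hypSixBilinTwo_mulVec D hq, hb1]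
  have hb2' : hypSixBilinTwo (hypSixF 0) y = 0 := by rw [hy, ← hf0, hypSixBilinTwo_mulVec D hq, hb2]
  obtain ⟨h1, h2, h3, h4⟩ := hypSixTab4_spec y ⟨hqy, hby, hb1', hb2'⟩
  set w := hypSixTab4.getD (hypSixCode y) []
  refine ⟨w.reverse, ?_, ?_, ?_, ?_⟩
  · rw [← Matrix.mulVec_mulVec, he0]
    conv_lhs => rw [← h1, ← hypSixEval_mulVec, Matrix.mulVec_mulVec, hypSixEval_reverse_mul, Matrix.one_mulVec]
  · rw [← Matrix.mulVec_mulVec, hf0]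
    conv_lhs => rw [← h2, ← hypSixEval_mulVec, Matrix.mulVec_mulVec, hypSixEval_reverse_mul, Matrix.one_mulVec]
  · rw [← Matrix.mulVec_mulVec, he1]
    conv_lhs => rw [← h3, ← hypSixEval_mulVec, Matrix.mulVec_mulVec, hypSixEval_reverse_mul, Matrix.one_mulVec]
  · rw [← Matrix.mulVec_mulVec, ← hy]
    conv_lhs => rw [← h4, ← hypSixEval_mulVec, Matrix.mulVec_mulVec, hypSixEval_reverse_mul, Matrix.one_mulVec]

/-- Two matrices with the same values on the basis `eₚ, fₚ` are equal. [folklore] -/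
private theorem hypSix_ext_of_mulVec_basis {D E : Matrix (Fin 3 ⊕ Fin 3) (Fin 3 ⊕ Fin 3) (ZMod 2)}
    (he : ∀ p, D *ᵥ hypSixE p = E *ᵥ hypSixE p) (hf : ∀ p, D *ᵥ hypSixF p = E *ᵥ hypSixF p) : D = E := by
  refine Matrix.ext fun i j ↦ ?_
  rcases j with p | p
  · have h := congrFun (he p) i
    simpa [hypSixE, Matrix.mulVec_single, Pi.single_apply] using h
  · have h := congrFun (hf p) i
    simpa [hypSixF, Matrix.mulVec_single, Pi.single_apply] using h

/-- Step 5: a `q̄`-orthogonal `D` fixing `e₀, f₀, e₁, f₁` is the identity or the swap `e₂ ↔ f₂`. [folklore] -/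
private theorem hypSix_step5 (hq : ∀ v, hypSixQuadTwo (D *ᵥ v) = hypSixQuadTwo v)
    (he0 : D *ᵥ hypSixE 0 = hypSixE 0) (hf0 : D *ᵥ hypSixF 0 = hypSixF 0) (he1 : D *ᵥ hypSixE 1 = hypSixE 1)
    (hf1 : D *ᵥ hypSixF 1 = hypSixF 1) : D = hypSixEval [] ∨ D = hypSixEval [14] := by
  obtain ⟨-, -, -, -, hqe2, hqf2, -, -, -, -, -, -, hb22, hb02, hb0'2, hb12, hb1'2, hb02', hb0'2', hb12', hb1'2', -⟩ :=
    hypSix_basis_values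
  have hB := hypSixBilinTwo_mulVec D hq
  have c1 : hypSixQuadTwo (D *ᵥ hypSixE 2) = 0 := by rw [hq, hqe2]
  have c2 : hypSixQuadTwo (D *ᵥ hypSixF 2) = 0 := by rw [hq, hqf2]
  have c3 : hypSixBilinTwo (D *ᵥ hypSixE 2) (D *ᵥ hypSixF 2) = 1 := by rw [hB, hb22]
  have c4 : hypSixBilinTwo (hypSixE 0) (D *ᵥ hypSixE 2) = 0 := by rw [← he0, hB, hb02]
  have c5 : hypSixBilinTwo (hypSixF 0) (D *ᵥ hypSixE 2) = 0 := by rw [← hf0, hB, hb0'2]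
  have c6 : hypSixBilinTwo (hypSixE 1) (D *ᵥ hypSixE 2) = 0 := by rw [← he1, hB, hb12]
  have c7 : hypSixBilinTwo (hypSixF 1) (D *ᵥ hypSixE 2) = 0 := by rw [← hf1, hB, hb1'2]
  have c8 : hypSixBilinTwo (hypSixE 0) (D *ᵥ hypSixF 2) = 0 := by rw [← he0, hB, hb02']
  have c9 : hypSixBilinTwo (hypSixF 0) (D *ᵥ hypSixF 2) = 0 := by rw [← hf0, hB, hb0'2']
  have c10 : hypSixBilinTwo (hypSixE 1) (D *ᵥ hypSixF 2) = 0 := by rw [← he1, hB, hb12']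
  have c11 : hypSixBilinTwo (hypSixF 1) (D *ᵥ hypSixF 2) = 0 := by rw [← hf1, hB, hb1'2']
  have hc : hypSixStep5Cond (D *ᵥ hypSixE 2) (D *ᵥ hypSixF 2) = true := by
    simp only [hypSixStep5Cond, c1, c2, c3, c4, c5, c6, c7, c8, c9, c10, c11]
    decide
  have h5 := hypSixStep5_spec (D *ᵥ hypSixE 2) (D *ᵥ hypSixF 2) hc
  obtain ⟨s0, s0', s1, s1', s2, s2'⟩ := hypSixGenTwo_swap_spec
  rcases h5 with ⟨hu, hv⟩ | ⟨hu, hv⟩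
  · left
    rw [hypSixEval_nil]
    refine hypSix_ext_of_mulVec_basis (fun p ↦ ?_) (fun p ↦ ?_)
    · fin_cases p
      · simpa using he0
      · simpa using he1
      · simpa using hu
    · fin_cases p
      · simpa using hf0
      · simpa using hf1
      · simpa using hv
  · right
    rw [hypSixEval_cons, hypSixEval_nil, Matrix.mul_one]
    refine hypSix_ext_of_mulVec_basis (fun p ↦ ?_) (fun p ↦ ?_)
    · fin_cases p
      · exact he0.trans s0.symm
      · exact he1.trans s1.symm
      · exact hu.trans s2.symm
    · fin_cases p
      · exact hf0.trans s0'.symm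
      · exact hf1.trans s1'.symm
      · exact hv.trans s2'.symm

/-- **Every `q̄`-orthogonal injective `D ∈ M₆(𝔽₂)` is a word in the reduced generators** (Witt's theorem for
`(𝔽₂⁶, q̄)` made effective by the stabiliser chain `35 · 16 · 9 · 4 · 2 = |O⁺₆(𝔽₂)|`). [cite: Nikulin1980, Thm. 1.14.2] -/
theorem exists_hypSixEval_eq (hq : ∀ v, hypSixQuadTwo (D *ᵥ v) = hypSixQuadTwo v)
    (hinj : Function.Injective D.mulVec) : ∃ w : List (Fin 15), hypSixEval w = D := by
  obtain ⟨w₁, h₁⟩ := hypSix_step1 D hq hinj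
  set D₁ := hypSixEval w₁ * D with hD₁
  have hq₁ := hypSix_orth_eval_mul D w₁ hq
  have hinj₁ := hypSix_inj_eval_mul D w₁ hinj
  obtain ⟨w₂, h₂e, h₂f⟩ := hypSix_step2 D₁ hq₁ h₁
  set D₂ := hypSixEval w₂ * D₁ with hD₂
  have hq₂ := hypSix_orth_eval_mul D₁ w₂ hq₁
  have hinj₂ := hypSix_inj_eval_mul D₁ w₂ hinj₁
  obtain ⟨w₃, h₃e, h₃f, h₃e'⟩ := hypSix_step3 D₂ hq₂ hinj₂ h₂e h₂f
  set D₃ := hypSixEval w₃ * D₂ with hD₃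
  have hq₃ := hypSix_orth_eval_mul D₂ w₃ hq₂
  obtain ⟨w₄, h₄e, h₄f, h₄e', h₄f'⟩ := hypSix_step4 D₃ hq₃ h₃e h₃f h₃e'
  set D₄ := hypSixEval w₄ * D₃ with hD₄
  have hq₄ := hypSix_orth_eval_mul D₃ w₄ hq₃
  have h5 := hypSix_step5 D₄ hq₄ h₄e h₄f h₄e' h₄f'
  -- unwind
  have e1 : D = hypSixEval w₁.reverse * D₁ := hypSix_eq_reverse_mul D rfl
  have e2 : D₁ = hypSixEval w₂.reverse * D₂ := hypSix_eq_reverse_mul D₁ rfl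
  have e3 : D₂ = hypSixEval w₃.reverse * D₃ := hypSix_eq_reverse_mul D₂ rfl
  have e4 : D₃ = hypSixEval w₄.reverse * D₄ := hypSix_eq_reverse_mul D₃ rfl
  rcases h5 with h5 | h5
  · refine ⟨w₁.reverse ++ (w₂.reverse ++ (w₃.reverse ++ (w₄.reverse ++ []))), ?_⟩
    rw [hypSixEval_append, hypSixEval_append, hypSixEval_append, hypSixEval_append, ← h5, ← e4, ← e3, ← e2, ← e1]
  · refine ⟨w₁.reverse ++ (w₂.reverse ++ (w₃.reverse ++ (w₄.reverse ++ [14]))), ?_⟩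
    rw [hypSixEval_append, hypSixEval_append, hypSixEval_append, hypSixEval_append, ← h5, ← e4, ← e3, ← e2, ← e1]

/-- **Every `q̄`-orthogonal automorphism of `𝔽₂⁶ = U^{⊕3}/2U^{⊕3}` lifts to an integral isometry of `U^{⊕3}`**:
for `D ∈ M₆(𝔽₂)` injective with `q̄(Dv) = q̄(v)` there is an integral `M` with `Mᵀ G M = G`, a two-sided integral
inverse, and `M mod 2 = D` — the computational content of the surjectivity `O(U(2)^{⊕3}) → O(q_{U(2)^{⊕3}})`
(Nikulin's Thm. 1.14.2 in the boundary case used by Huybrechts' Cor. 3.15, Rem. 1.13 (i)).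
[cite: Nikulin1980, Thm. 1.14.2] [cite: Huybrechts2016K3, Ch. 14 Rem. 1.13 (i), Cor. 3.15] -/
theorem exists_integral_lift_of_orthogonal_mod_two (hq : ∀ v, hypSixQuadTwo (D *ᵥ v) = hypSixQuadTwo v)
    (hinj : Function.Injective D.mulVec) :
    ∃ M N : Matrix (Fin 3 ⊕ Fin 3) (Fin 3 ⊕ Fin 3) ℤ, Mᵀ * hypSixGram * M = hypSixGram ∧ M * N = 1 ∧ N * M = 1 ∧
      M.map (Int.castRingHom (ZMod 2)) = D := by
  obtain ⟨w, hw⟩ := exists_hypSixEval_eq D hq hinj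
  exact ⟨hypSixEvalInt w, hypSixEvalIntInv w, hypSixEvalInt_transpose_mul_mul w, hypSixEvalInt_mul_inv w,
    hypSixEvalIntInv_mul w, (hypSixEvalInt_map w).trans hw⟩

end Descent

end Literature.Topology.FourManifolds
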